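import Mathlib
import Literature.MathematicalPhysics.QuantumFieldTheory.Balaban1983to89.B12FaddeevPopov016
import Literature.MathematicalPhysics.QuantumFieldTheory.Balaban1983to89.T4AxialGaugeFixing

/-!
# `Balaban1983to89.B14Eq16FaddeevPopov` — T. Bałaban, *Convergent renormalization expansions for lattice gauge theories*, Commun. Math. Phys. **119** (1988) 243–285 [Balaban1988Convergent]: the Faddeev–Popov procedure behind (1.5) ⇒ (1.6) p. 247 for a PARTIAL axial gauge fixing (only the blocks `B(y)`, `y ∈ P₁¹`) — PROVED; the assembly of (1.6) itself (row B14.Eq1.6, decl `B14.Sect1Repr.Eq16`) is the sibling `…B14Eq16Proof` of the same seat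

statement-level skeleton of published theorems with citation tags; proofs where landed; nothing here is a claim about the Yang–Mills mass gap

PDF held: `paper:balaban1988-cmp119-convergent-renormalization` (journal page = PDF page + 242); (1.5)–(1.7) read on the page render
`…-p005-x2.png` (p. 247) of `run/shared/lean/pub/pub-balaban/b2b-balaban-ref1/pages/1988-cmp119-convergent-renormalization/`, READ AS
AN IMAGE; (0.13)–(0.16) of [I] = [Balaban1987RG1] pp. 254–255 as quoted in the header of `…B12FaddeevPopov016`.

WHAT IS REPRODUCED (Phase-2 seat p28, generation 2, of the mega-formalization `lit-balaban`; SKELETON row **B14.Eq1.6**, file 1/2).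
p. 247 [PDF 5], verbatim: *"1 = Π_{y∈P₁¹} Π_{x∈B(y), x≠y} ∫du(x) (1/z) χ({|U^u(y,x) − 1| < ε₀}) exp[−(1/g₀²)[1 − Re tr U^u(y,x)]],   (1.5)
where U(y,x) are the variables introduced by (0.11) [I]. We insert it under the integral, and we apply the Faddeev-Popov procedure.
This yields the equality ρ₁(V) = Σ_{P₀P₁} χ₁ᶜ(P₁)χ₁(P₁ᶜ) ∫dU δ(ŪV⁻¹) χ₀ᶜ(P₀)χ₀(P₀ᶜ)χ_{Ax}(P₁¹)
· exp[−(1/g₀²) 𝐆(P₁¹, U) − (1/g₀²) A(U) − (L⁴ − 1)|P₁¹| log z − E],   (1.6)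
where 𝐆(P₁¹, U) = Σ_{y∈P₁¹} Σ_{x∈B(y), x≠y} [1 − Re tr U(y,x)].   (1.7)"*
The "Faddeev-Popov procedure" is the one printed in [I] p. 255 for (0.16): *"we change the order of integrations and apply the gauge
transformation U → U^{u⁻¹} with u(y) = 1 for y ∈ T⁽¹⁾. By the gauge invariance with respect to such transformations the integrand does
not depend on u and the integral over u is equal to 1"* — printed there for the gauge fixing on ALL blocks and PROVED in the tree in that
form (`B12FaddeevPopov016.fp016_of_fineInvariant`, unit r09); (1.5)/(1.6) fix the gauge only on the blocks `B(y)`, `y ∈ P₁¹`, which is the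
generalisation proved here (for every lattice level `j`, every finite set `Y` of block centres, every integrable fine-gauge-invariant
integrand `F` — kernel integrands `t(V,U)ρ(U)` of [I] (0.13) and push-forward integrands `ρ(U)f(Ū)` of (0.1) alike).

CONTENTS.
§0  lattice bookkeeping for the factors of (1.6): gauge invariance of the Wilson action `A` (`wilsonAction4_gaugeAct'`, from the tree's
    `T4ReTrLipUnitary.plaqHol_gaugeAct` and `Re tr (h g h⁻¹) = Re tr g`) and `Ū^u = Ū` for `u = 1` at the centres
    (`avg_gaugeAct_of_fineGauge`); the gauge invariance / measurability / bounds of the small-plaquette characteristic functions `χ` are the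
    tree's `T4SmallFieldWindowSandwich.chiSmall_gaugeAct`, `T4AxialGaugeFixing.measurable_chiSmall`, `T4ExpWindowSmallField.chiSmall_nonneg`
    / `chiSmall_le_one`, `Missing.measurable_wilsonAction4` (imported through `…T4AxialGaugeFixing`, used by name in file 2/2).
§1  `integral_eq_integral_weight_mul` — THE FADDEEV–POPOV PROCEDURE FOR A PARTIAL GAUGE FIXING:
    `∫dU F(U) = ∫dU [Π_{y∈Y} Π_{x∈B(y),x≠y} (1/z) χ({|U(y,x)−1|<ε₀}) e^{−(1/α)[1−Re tr U(y,x)]}] F(U)`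
    (insert (1.5) = `fp015` for the pairs `(y,x)`, `y ∈ Y`; Fubini; `U → U^u` with r09's `fineTransf`; Haar invariance of `dU`
    (`integral_comp_gaugeAct`); the `u`-integral of the constant is the constant); `integrable_weight_mul`.
§2  `weight_eq` — the inserted product is `[Π_{y∈Y}Π_{x≠y} χ({|U(y,x)−1|<ε₀})]·exp[−(1/α)𝐆(Y,U) − (L^d − 1)|Y| log z]`, with
    (1.7) = `Setup.gaugeFixFn` and `|B(y)∖{y}| = L^d − 1` (`Site.card_block`); this is where the printed `(L⁴ − 1)|P₁¹| log z` comes from.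

Mega-formalization `lit-balaban`, unit `lit-balaban-p28` (gen 2), HOME `run/shared/lean/pub/lit-balaban/`.

## References
* [Balaban1988Convergent] T. Bałaban, Commun. Math. Phys. 119 (1988) 243–285, (1.5)–(1.7) p. 247.
* [Balaban1987RG1] T. Bałaban, Commun. Math. Phys. 109 (1987) 249–301, (0.13)–(0.16) pp. 254–255.
-/

noncomputable section

open scoped BigOperators
open _root_.MeasureTheory

namespace Literature.MathematicalPhysics.QuantumFieldTheory.Balaban1983to89.B14Eq16FaddeevPopov

open Literature.MathematicalPhysics.QuantumFieldTheory.Balaban1983to89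
open B12FaddeevPopov016

/-! ## §0. Lattice bookkeeping: gauge invariance and measurability of the factors of (1.6) -/

section Bookkeeping

variable {P : Params} {j : ℕ} {G : Type*} [GaugeGroup G]

/-- Gauge invariance of the Wilson action `A(U)` of (0.2): `A(U^u) = A(U)` (`U^u(∂p) = u(p₋)U(∂p)u(p₋)⁻¹`, the tree's
`T4ReTrLipUnitary.plaqHol_gaugeAct`, and `Re tr (h g h⁻¹) = Re tr g`; the weighted form is the tree's
`T4WilsonGaugeFlatDirection.wilsonAction_gaugeAct`). [cite: Balaban1988Convergent, (0.2) p.244] -/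
theorem wilsonAction4_gaugeAct' (u : GaugeTransf P j G) (U : GaugeField P j G) :
    wilsonAction4 (GaugeField.gaugeAct u U) = wilsonAction4 U := by
  unfold wilsonAction4 wilsonAction
  simp only [T4ReTrLipUnitary.plaqHol_gaugeAct, GaugeGroup.reTr_conj]

/-- For a gauge transformation `u` with `u(y) = 1` at the block centres, the induced coarse transformation `u ∘ emb` is
trivial: `W^{u∘emb} = W` ([I] p. 255: the residual transformations do not move the coarse field). [cite: Balaban1987RG1, (0.13) p.254] -/
theorem gaugeAct_emb_of_fineGauge {u : GaugeTransf P j G} (hu : FineGauge u) (W : GaugeField P (j+1) G) :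
    GaugeField.gaugeAct (fun y => u (emb y)) W = W := by
  funext b
  simp [GaugeField.gaugeAct, hu b.src, hu b.tgt]

/-- `Ū^u = Ū` for `u = 1` at the centres: an averaging (gauge covariant, `Setup.Averaging.covariant`) is INVARIANT under the
residual gauge transformations of [I] p. 254 — the reason the δ-function `δ(ŪV⁻¹)` of (0.1)/(1.6) survives the Faddeev–Popov step
(standing range `j + 1 ≤ m + K`). [cite: Balaban1988Convergent, (1.6) p.247] -/
theorem avg_gaugeAct_of_fineGauge (hj : j + 1 ≤ P.m + P.K) (av : Averaging P j G) {u : GaugeTransf P j G}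
    (hu : FineGauge u) (U : GaugeField P j G) : av.avg (GaugeField.gaugeAct u U) = av.avg U := by
  rw [av.covariant hj u U, gaugeAct_emb_of_fineGauge hu]

end Bookkeeping

/-! ## §1. The Faddeev–Popov procedure for a PARTIAL gauge fixing (the mechanism of (1.5) ⇒ (1.6)) -/

section PartialFP

variable {P : Params} {j : ℕ} {G : Type*} [GaugeGroup G]

/-- Regrouping of a product over the pairs `(y,x)`, `x ∈ B(y)∖{y}`, that is trivial off `Y`, as the printed double product
`Π_{y∈Y} Π_{x∈B(y), x≠y}` of (1.5)/(1.6). [cite: Balaban1988Convergent, (1.5) p.247] -/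
theorem prod_idx_ite (Y : Finset (Site P (j+1))) (f : Site P (j+1) → Site P j → ℝ) :
    (∏ i : FPIdx P j, if (i.1 : Site P (j+1)) ∈ Y then f i.1 i.2 else 1) =
      ∏ y ∈ Y, ∏ x ∈ (block y).erase (emb y), f y x := by
  rw [Fintype.prod_sigma'
    (fun (y : Site P (j+1)) (x : ((block y).erase (emb y) : Finset (Site P j))) => if y ∈ Y then f y x else 1)]
  have h : ∀ y : Site P (j+1),
      (∏ x : ((block y).erase (emb y) : Finset (Site P j)), if y ∈ Y then f y x else 1) =
        if y ∈ Y then ∏ x ∈ (block y).erase (emb y), f y x else 1 := by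
    intro y
    by_cases hy : y ∈ Y
    · simp only [hy, if_true]
      exact Finset.prod_coe_sort _ _
    · simp only [hy, if_false]
      exact Finset.prod_const_one
  simp_rw [h]
  rw [Finset.prod_ite_mem, Finset.univ_inter]

variable [MeasurableSpace G] [HaarData G] [RegularGaugeGroup G]

/-- **THE FADDEEV–POPOV PROCEDURE FOR A PARTIAL GAUGE FIXING** (p. 247: *"We insert it under the integral, and we apply
the Faddeev-Popov procedure"*, the procedure being [I] p. 255).  For a finite set `Y` of block centres of `T^{(j+1)}`, a
`dU`-integrable function `F` invariant under the gauge transformations `u` with `u(y) = 1`, `y ∈ T^{(j+1)}`, measurable contour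
variables `U ↦ U(y,x)`, `α > 0` and `z = z(α, ε₀) ≠ 0`:
`∫dU F(U) = ∫dU [Π_{y∈Y} Π_{x∈B(y),x≠y} (1/z) χ({|U(y,x) − 1| < ε₀}) exp[−(1/α)[1 − Re tr U(y,x)]]] F(U)`.
Proof = the printed one: insert the identities (1.5) (= `fp015`, one per pair `(y,x)`, `y ∈ Y`), exchange the integrations
(Fubini), substitute `U → U^u` with `u = 1` off the blocks and at the centres (`fineTransf`), use the invariance of `F` and of
`dU`; the remaining `u`-integral of a constant is that constant.  (r09's `fp016_of_fineInvariant` is the case `Y = T^{(j+1)}`,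
`F = t(V,·)ρ`.) [cite: Balaban1988Convergent, (1.5)–(1.6) p.247] -/
theorem integral_eq_integral_weight_mul (hj : j + 1 ≤ P.m + P.K) (cd : ContourData P j G)
    (hcd : ∀ (y : Site P (j+1)) (x : Site P j), Measurable fun U : GaugeField P j G => cd.holTo U y x)
    {α ε₀ : ℝ} (hα : 0 < α) (hz : B16ZLower.zNorm G α ε₀ ≠ 0) (Y : Finset (Site P (j+1)))
    {F : GaugeField P j G → ℝ} (hF : FineGaugeInvariant F) (hFi : Integrable F (fieldMeasure P j G)) :
    ∫ U, F U ∂(fieldMeasure P j G) =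
      ∫ U, (∏ y ∈ Y, ∏ x ∈ (block y).erase (emb y),
        (B16ZLower.zNorm G α ε₀)⁻¹ * fpIntegrand α ε₀ (cd.holTo U y x)) * F U ∂(fieldMeasure P j G) := by
  set z : ℝ := B16ZLower.zNorm G α ε₀ with hzdef
  set η : Measure (FPIdx P j → G) := Measure.pi fun _ => (HaarData.haar : Measure G) with hη
  -- the doubled integrand: one factor (1.5) per pair `(y,x)` with `y ∈ Y`, the factor `1` for the other pairs
  set Φ : GaugeField P j G → (FPIdx P j → G) → ℝ := fun U g =>
    F U * ∏ i : FPIdx P j, (if (i.1 : Site P (j+1)) ∈ Y then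
      z⁻¹ * fpIntegrand α ε₀ (cd.holTo U i.1 i.2 * (g i)⁻¹) else 1) with hΦ
  -- Step 1 (insert (1.5)): for every `U` the `g`-integral of the product of the factors is `1`.
  have h1 : ∀ U : GaugeField P j G,
      ∫ g, (∏ i : FPIdx P j, (if (i.1 : Site P (j+1)) ∈ Y then
        z⁻¹ * fpIntegrand α ε₀ (cd.holTo U i.1 i.2 * (g i)⁻¹) else 1)) ∂η = 1 := by
    intro U
    rw [hη, integral_fintype_prod_eq_prod
      (fun (i : FPIdx P j) (w : G) => if (i.1 : Site P (j+1)) ∈ Y then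
        z⁻¹ * fpIntegrand α ε₀ (cd.holTo U i.1 i.2 * w⁻¹) else 1)]
    refine Finset.prod_eq_one fun i _ => ?_
    by_cases hi : (i.1 : Site P (j+1)) ∈ Y
    · simp only [hi, if_true]
      rw [integral_const_mul, fp015, hzdef, inv_mul_cancel₀ hz]
    · simp only [hi, if_false]
      simp
  -- Step 2: `∫dU F = ∫dU ∫dg Φ`.
  have h2 : ∫ U, F U ∂(fieldMeasure P j G) = ∫ U, ∫ g, Φ U g ∂η ∂(fieldMeasure P j G) := by
    refine integral_congr_ae (Filter.Eventually.of_forall fun U => ?_)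
    simp only [hΦ]
    rw [integral_const_mul, h1 U, mul_one]
  -- Step 3: Fubini.
  have hΦ_int : Integrable (Function.uncurry Φ) ((fieldMeasure P j G).prod η) := by
    have ha : Integrable (fun p : GaugeField P j G × (FPIdx P j → G) => F p.1) ((fieldMeasure P j G).prod η) :=
      hFi.comp_fst η
    have hb_meas : Measurable (fun p : GaugeField P j G × (FPIdx P j → G) =>
        ∏ i : FPIdx P j, (if (i.1 : Site P (j+1)) ∈ Y then
          z⁻¹ * fpIntegrand α ε₀ (cd.holTo p.1 i.1 i.2 * (p.2 i)⁻¹) else 1)) := by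
      refine Finset.measurable_prod _ fun i _ => ?_
      by_cases hi : (i.1 : Site P (j+1)) ∈ Y
      · simp only [hi, if_true]
        have hm1 : Measurable fun p : GaugeField P j G × (FPIdx P j → G) => cd.holTo p.1 i.1 i.2 :=
          (hcd i.1 i.2).comp measurable_fst
        have hm2 : Measurable fun p : GaugeField P j G × (FPIdx P j → G) => (p.2 i)⁻¹ :=
          ((measurable_pi_apply i).comp measurable_snd).inv
        exact (measurable_const.mul (measurable_fpIntegrand α ε₀)).comp (hm1.mul hm2)
      · simp only [hi, if_false]
        exact measurable_const
    have hb_bdd : ∀ p : GaugeField P j G × (FPIdx P j → G),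
        ‖∏ i : FPIdx P j, (if (i.1 : Site P (j+1)) ∈ Y then
          z⁻¹ * fpIntegrand α ε₀ (cd.holTo p.1 i.1 i.2 * (p.2 i)⁻¹) else 1)‖
          ≤ (max |z|⁻¹ 1) ^ Fintype.card (FPIdx P j) := by
      intro p
      rw [Real.norm_eq_abs, Finset.abs_prod, ← Finset.card_univ, ← Finset.prod_const]
      refine Finset.prod_le_prod (fun i _ => abs_nonneg _) fun i _ => ?_
      by_cases hi : (i.1 : Site P (j+1)) ∈ Y
      · simp only [hi, if_true]
        rw [abs_mul, abs_inv]
        calc |z|⁻¹ * |fpIntegrand α ε₀ (cd.holTo p.1 i.1 i.2 * (p.2 i)⁻¹)|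
            ≤ |z|⁻¹ * 1 :=
              mul_le_mul_of_nonneg_left (abs_fpIntegrand_le_one hα ε₀ _) (inv_nonneg.2 (abs_nonneg z))
          _ = |z|⁻¹ := mul_one _
          _ ≤ max |z|⁻¹ 1 := le_max_left _ _
      · simp only [hi, if_false, abs_one]
        exact le_max_right _ _
    have h := ha.bdd_mul hb_meas.aestronglyMeasurable (Filter.Eventually.of_forall hb_bdd)
    refine h.congr (Filter.Eventually.of_forall fun p => ?_)
    simp only [hΦ, Function.uncurry]
    ring
  rw [h2, integral_integral_swap hΦ_int]
  -- Step 4: for fixed `g` gauge-transform `U`; the inner integral no longer depends on `g`.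
  have h4 : ∀ g : FPIdx P j → G, ∫ U, Φ U g ∂(fieldMeasure P j G) =
      ∫ U, (∏ y ∈ Y, ∏ x ∈ (block y).erase (emb y), z⁻¹ * fpIntegrand α ε₀ (cd.holTo U y x)) * F U
        ∂(fieldMeasure P j G) := by
    intro g
    have hu : FineGauge (fineTransf g) := fineGauge_fineTransf hj g
    have hpt : ∀ U : GaugeField P j G, Φ U g =
        (fun W : GaugeField P j G =>
          (∏ y ∈ Y, ∏ x ∈ (block y).erase (emb y), z⁻¹ * fpIntegrand α ε₀ (cd.holTo W y x)) * F W)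
          (GaugeField.gaugeAct (fineTransf g) U) := by
      intro U
      have key := prod_idx_ite Y
        (fun y x => z⁻¹ * fpIntegrand α ε₀ (cd.holTo (GaugeField.gaugeAct (fineTransf g) U) y x))
      simp only [hΦ]
      rw [hF _ hu U, ← key]
      simp_rw [holTo_gaugeAct_fineTransf hj cd g U]
      ring
    simp_rw [hpt]
    exact integral_comp_gaugeAct (fineTransf g) (fun W : GaugeField P j G =>
      (∏ y ∈ Y, ∏ x ∈ (block y).erase (emb y), z⁻¹ * fpIntegrand α ε₀ (cd.holTo W y x)) * F W)
  simp_rw [h4]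
  rw [integral_const, hη]
  simp

omit [HaarData G] in
/-- The inserted product of (1.6) is a bounded measurable function of `U`, so that multiplying an integrable integrand by it
keeps it integrable (used when the finite sums of (1.6) are exchanged with the integral). [cite: Balaban1988Convergent, (1.6) p.247] -/
theorem integrable_weight_mul (μ : Measure (GaugeField P j G)) (cd : ContourData P j G)
    (hcd : ∀ (y : Site P (j+1)) (x : Site P j), Measurable fun U : GaugeField P j G => cd.holTo U y x)
    {α : ℝ} (hα : 0 < α) (ε₀ z : ℝ) (Y : Finset (Site P (j+1))) {H : GaugeField P j G → ℝ}
    (hH : Integrable H μ) :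
    Integrable (fun U => (∏ y ∈ Y, ∏ x ∈ (block y).erase (emb y), z⁻¹ * fpIntegrand α ε₀ (cd.holTo U y x)) * H U)
      μ := by
  have hmf : Measurable (fpIntegrand (G := G) α ε₀) := measurable_fpIntegrand α ε₀
  have hmeas : Measurable fun U : GaugeField P j G =>
      ∏ y ∈ Y, ∏ x ∈ (block y).erase (emb y), z⁻¹ * fpIntegrand α ε₀ (cd.holTo U y x) := by
    refine Finset.measurable_prod _ fun y _ => ?_
    refine Finset.measurable_prod _ fun x _ => ?_
    exact (measurable_const.mul hmf).comp (hcd y x)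
  have hbdd : ∀ U : GaugeField P j G,
      ‖∏ y ∈ Y, ∏ x ∈ (block y).erase (emb y), z⁻¹ * fpIntegrand α ε₀ (cd.holTo U y x)‖ ≤
        ∏ y ∈ Y, ∏ _x ∈ (block y).erase (emb y), |z|⁻¹ := by
    intro U
    rw [Real.norm_eq_abs, Finset.abs_prod]
    refine Finset.prod_le_prod (fun y _ => abs_nonneg _) fun y _ => ?_
    rw [Finset.abs_prod]
    refine Finset.prod_le_prod (fun x _ => abs_nonneg _) fun x _ => ?_
    rw [abs_mul, abs_inv]
    calc |z|⁻¹ * |fpIntegrand α ε₀ (cd.holTo U y x)|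
        ≤ |z|⁻¹ * 1 := mul_le_mul_of_nonneg_left (abs_fpIntegrand_le_one hα ε₀ _) (inv_nonneg.2 (abs_nonneg z))
      _ = |z|⁻¹ := mul_one _
  exact hH.bdd_mul hmeas.aestronglyMeasurable (Filter.Eventually.of_forall hbdd)

end PartialFP

/-! ## §2. The inserted product is `χ_{Ax}(Y) · exp[−(1/α) 𝐆(Y,U) − (L^d − 1)|Y| log z]` -/

section Weight

variable {P : Params} {j : ℕ} {G : Type*} [GaugeGroup G]

/-- The number of gauge-fixing factors of (1.5) per block: `|B(y)∖{y}| = L^d − 1` (standing range `j + 1 ≤ m + K`;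
`Site.card_block`, `Site.emb_mem_block`). [cite: Balaban1988Convergent, (1.6) p.247] -/
theorem card_block_erase (hj : j + 1 ≤ P.m + P.K) (y : Site P (j+1)) :
    ((block y).erase (emb y)).card = P.L ^ P.d - 1 := by
  rw [Finset.card_erase_of_mem (Site.emb_mem_block hj y), Site.card_block hj y]

/-- The constant factors: `Π_{y∈Y} Π_{x∈B(y),x≠y} z⁻¹ = exp[−(L^d − 1)|Y| log z]` for `z > 0` — the origin of the term
`−(L⁴ − 1)|P₁¹| log z` in the exponent of (1.6). [cite: Balaban1988Convergent, (1.6) p.247] -/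
theorem prod_inv_z_eq_exp (hj : j + 1 ≤ P.m + P.K) {z : ℝ} (hz : 0 < z) (Y : Finset (Site P (j+1))) :
    (∏ y ∈ Y, ∏ _x ∈ (block y).erase (emb y), z⁻¹) =
      Real.exp (-(((P.L : ℝ) ^ P.d - 1) * (Y.card : ℝ) * Real.log z)) := by
  have hL : ((P.L ^ P.d - 1 : ℕ) : ℝ) = (P.L : ℝ) ^ P.d - 1 := by
    have h1 : 1 ≤ P.L ^ P.d := Nat.one_le_pow _ _ P.L_pos
    rw [Nat.cast_sub h1, Nat.cast_pow, Nat.cast_one]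
  simp_rw [Finset.prod_const, card_block_erase hj]
  rw [Finset.prod_const, ← pow_mul, ← hL, ← Nat.cast_mul, Real.exp_neg, Real.exp_nat_mul, Real.exp_log hz, inv_pow]

open Classical in
/-- **The inserted product, rewritten.**  For `z > 0`:
`Π_{y∈Y} Π_{x∈B(y),x≠y} (1/z) χ({|U(y,x) − 1| < ε₀}) exp[−(1/α)[1 − Re tr U(y,x)]]
  = [Π_{y∈Y} Π_{x∈B(y),x≠y} χ({|U(y,x) − 1| < ε₀})] · exp[−(1/α) 𝐆(Y,U) − (L^d − 1)|Y| log z]`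
with `𝐆(Y,U) = Σ_{y∈Y} Σ_{x∈B(y),x≠y} [1 − Re tr U(y,x)]` (1.7) (`Setup.gaugeFixFn`). [cite: Balaban1988Convergent, (1.6)–(1.7) p.247] -/
theorem weight_eq (hj : j + 1 ≤ P.m + P.K) (cd : ContourData P j G) (α ε₀ : ℝ) {z : ℝ} (hz : 0 < z)
    (Y : Finset (Site P (j+1))) (U : GaugeField P j G) :
    (∏ y ∈ Y, ∏ x ∈ (block y).erase (emb y), z⁻¹ * fpIntegrand α ε₀ (cd.holTo U y x)) =
      (∏ y ∈ Y, ∏ x ∈ (block y).erase (emb y), if dist1 (cd.holTo U y x) < ε₀ then (1 : ℝ) else 0) *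
        Real.exp (-(1 / α) * gaugeFixFn cd Y U - ((P.L : ℝ) ^ P.d - 1) * (Y.card : ℝ) * Real.log z) := by
  -- split each factor into its three pieces
  have hsplit : ∀ (y : Site P (j+1)) (x : Site P j), z⁻¹ * fpIntegrand α ε₀ (cd.holTo U y x) =
      (if dist1 (cd.holTo U y x) < ε₀ then (1 : ℝ) else 0) *
        (Real.exp (-(1 / α) * (1 - reTr (cd.holTo U y x))) * z⁻¹) := by
    intro y x
    unfold fpIntegrand
    by_cases h : cd.holTo U y x ∈ {v : G | dist1 v < ε₀}
    · have h' : dist1 (cd.holTo U y x) < ε₀ := h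
      simp only [if_pos h', Set.indicator_of_mem h]
      ring
    · have h' : ¬ dist1 (cd.holTo U y x) < ε₀ := h
      simp only [if_neg h', Set.indicator_of_notMem h]
      ring
  simp_rw [hsplit, Finset.prod_mul_distrib]
  -- the exponential factors
  have hexp : (∏ y ∈ Y, ∏ x ∈ (block y).erase (emb y), Real.exp (-(1 / α) * (1 - reTr (cd.holTo U y x)))) =
      Real.exp (-(1 / α) * gaugeFixFn cd Y U) := by
    unfold gaugeFixFn
    rw [Finset.mul_sum, Real.exp_sum]
    refine Finset.prod_congr rfl fun y _ => ?_
    rw [Finset.mul_sum, Real.exp_sum]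
  rw [prod_inv_z_eq_exp hj hz Y, hexp]
  have hsum : Real.exp (-(1 / α) * gaugeFixFn cd Y U - ((P.L : ℝ) ^ P.d - 1) * (Y.card : ℝ) * Real.log z) =
      Real.exp (-(1 / α) * gaugeFixFn cd Y U) *
        Real.exp (-(((P.L : ℝ) ^ P.d - 1) * (Y.card : ℝ) * Real.log z)) := by
    rw [sub_eq_add_neg, Real.exp_add]
  rw [hsum]

end Weight

end Literature.MathematicalPhysics.QuantumFieldTheory.Balaban1983to89.B14Eq16FaddeevPopov

end
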